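import Literature.MathematicalPhysics.KineticTheory.ConfinedSkeletonFlow
import Literature.MathematicalPhysics.KineticTheory.LangevinChainLinearControl
import HarnessLib

/-!
# Additive-noise SDEs with a confined drift: the linearised dynamics at an equilibrium is controllable through a fine enough noise skeleton

Trunk T-KINETIC (Literature/MathematicalPhysics/KineticTheory). Model-free version of
`LangevinChainLinearControl.lean` (there: the pinned chain, the older pipeline), the SURJECTIVITY
input of the Hörmander-free local minorisation of the transition probabilities of
`dz = Y(z) dt + v₁ dB¹ + v₂ dB²` near an EQUILIBRIUM `x₀` (`Y x₀ = 0`). With the solution family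
`S(z, x, ρ) ∈ C(I, E)` of `ConfinedSkeletonFlow.lean` (initial condition `z`, dyadic noise skeleton
`x ∈ (ℝ^{2^m})²`, remainder noise path `ρ`), characterised by the parametric Robbin equation:

* `ConfinedDrift.skelSol_base_of_unique` — `S(x₀, 0, 0)` is the constant path `x₀`;
* `ConfinedDrift.fderiv_skelSol_base_eq` — the variational equation at `(x₀, 0, 0)` is the
  constant-coefficient linear Volterra equation `w = gδ + V_A w`, `A = DY(x₀)`;
* `ConfinedDrift.dual_fderiv_skelSol_indicator` — the dual value along the indicator skeleton
  `(1_{i<k}, 0)` is `2ᵐ (c ℓ(v₁) + ∫₀¹ min(c,t) ℓ(e^{(1-t)A} A v₁) dt)`, `c = k/2ᵐ` (ramp forcing +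
  the duality formula of `LinearVolterraDuality.lean`);
* `ConfinedDrift.dual_eq_zero_of_forall_level` — under the KALMAN HYPOTHESIS on `(A, v₁)`
  (`ℓ(Aᵏv₁) = 0 ∀k ⟹ ℓ = 0`; for chains: `OscillatorChain.eq_zero_of_forall_pow_unitP_zero₂`,
  `LangevinChainConfinedKalman.lean`), a functional annihilating all dual values vanishes;
* `ConfinedDrift.exists_skeleton_level_surjective` — **for some level `m`, the differential of
  `x ↦ S(x₀, x, 0)(1)` at `x = 0` is ONTO `E`** (the reachable subspaces increase with `m` by
  refinement of skeletons and stabilise by Noetherianity; a functional killing the stable value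
  would kill every dual value).

## References

* N. Cuneo, J.-P. Eckmann, M. Hairer, L. Rey-Bellet, EJP **23** (2018) no. 55, §4;
  E. D. Sontag, *Mathematical Control Theory* (1998), Ch. 3. [folklore]
-/

noncomputable section

open MeasureTheory Filter Topology Set Metric Function unitInterval NormedSpace
open scoped NNReal

namespace Literature.MathematicalPhysics.KineticTheory

open Literature.Probability.Process Literature.Analysis.ODE
open Literature.MathematicalPhysics.KineticTheory.HeatConduction (plInterp_indicator exists_plInterp_refine)

variable {E : Type*} [NormedAddCommGroup E] [NormedSpace ℝ E]

/-! ### Nemytskii operators at constant paths -/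

omit [NormedSpace ℝ E] in
/-- The Nemytskii operator of a continuous map at a constant path is the constant path.
[folklore] -/
theorem nemytskii_const {F : Type*} [NormedAddCommGroup F] [NormedSpace ℝ F] {f : E → F}
    (hf : Continuous f) (x₀ : E) :
    nemytskii f (ContinuousMap.const I x₀) = ContinuousMap.const I (f x₀) := by
  refine ContinuousMap.ext fun τ => ?_
  rw [nemytskii_apply (hf.comp (map_continuous _)), ContinuousMap.const_apply, ContinuousMap.const_apply]

namespace ConfinedDrift

variable [FiniteDimensional ℝ E] [CompleteSpace E] {Y : E → E} (D : ConfinedDrift Y)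
  (hY : ContDiff ℝ 1 Y) {x₀ : E} (hx₀ : Y x₀ = 0)
  (m : ℕ) {v₁ v₂ : E} (hv₁ : v₁ ∈ D.noise) (hv₂ : v₂ ∈ D.noise)
  (g : E × PairSkeleton m × C(I, D.noise) →L[ℝ] C(I, E))
  (hg : ∀ (p : E × PairSkeleton m × C(I, D.noise)) (τ : I),
    g p τ = p.1 + skelNoisePath m v₁ v₂ p.2.1 p.2.2 τ)
  {S : E × PairSkeleton m × C(I, D.noise) → C(I, E)}
  (hS : ∀ p, forcedRobbinMap Y g (p, S p) = 0)
  (huniq : ∀ p α, forcedRobbinMap Y g (p, α) = 0 → α = S p)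
include D hY hx₀ hv₁ hv₂ hg hS huniq

/-! ### The variational equation at the base parameter `(x₀, 0, 0)` -/

omit [FiniteDimensional ℝ E] [CompleteSpace E] hY hv₁ hv₂ hS in
/-- The solution at the base parameter `(x₀, 0, 0)` is the constant path `x₀` (uniqueness).
[folklore] -/
theorem skelSol_base_of_unique : S (x₀, 0, 0) = ContinuousMap.const I x₀ := by
  refine (huniq (x₀, 0, 0) (ContinuousMap.const I x₀) ?_).symm
  have hg0 : g (x₀, (0 : PairSkeleton m), (0 : C(I, D.noise))) = ContinuousMap.const I x₀ := by
    refine ContinuousMap.ext fun τ => ?_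
    rw [hg, ContinuousMap.const_apply]
    simp only
    rw [skelNoisePath_zero m v₁ v₂, Pi.zero_apply, add_zero]
  show g (x₀, (0 : PairSkeleton m), (0 : C(I, D.noise))) +
    primitiveCLM (nemytskii Y (ContinuousMap.const I x₀)) - ContinuousMap.const I x₀ = 0
  rw [hg0, nemytskii_const D.contDiff_drift.continuous, hx₀]
  have : (ContinuousMap.const I (0 : E)) = 0 := rfl
  rw [this, map_zero, add_zero, sub_self]

omit hv₁ hv₂ in
/-- **The variational equation along a parameter direction is a constant-coefficient linear
Volterra equation**: `w = DS(x₀,0,0)δ` satisfies `w = g δ + V_A w`, `A = DY(x₀)`. [folklore] -/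
theorem fderiv_skelSol_base_eq (δ : E × PairSkeleton m × C(I, D.noise)) :
    fderiv ℝ S (x₀, 0, 0) δ = g δ + volterraCLM (ContinuousMap.const I (fderiv ℝ Y x₀))
      (fderiv ℝ S (x₀, 0, 0) δ) := by
  have h := fderiv_forcedSolution_family_eq hY g.contDiff le_rfl hS huniq (x₀, 0, 0) δ
  rw [D.skelSol_base_of_unique hx₀ m g hg huniq,
    nemytskii_const (hY.continuous_fderiv one_ne_zero) x₀, ContinuousLinearMap.fderiv] at h
  exact h

omit hv₁ hv₂ in
/-- **The dual value of the differential along an indicator skeleton.** For the skeleton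
`x = (1_{i<k}, 0)` of level `m` (`k ≤ 2ᵐ`) and every continuous linear functional `ℓ`,
`ℓ(DS(x₀,0,0)(0, x, 0)(1)) = 2ᵐ (c ℓ(v₁) + ∫₀¹ min(c,t) ℓ(e^{(1-t)A} A v₁) dt)`, `c = k/2ᵐ`
(the forcing is the ramp `(2ᵐ min(c, τ)) • v₁`). [folklore] -/
theorem dual_fderiv_skelSol_indicator (ℓ : E →L[ℝ] ℝ) (k : ℕ) (hk : k ≤ 2 ^ m) :
    ℓ (fderiv ℝ S (x₀, 0, 0) ((0 : E), ((fun i : Fin (2 ^ m) => if i.val < k then (1 : ℝ) else 0),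
        (0 : Fin (2 ^ m) → ℝ)), (0 : C(I, D.noise))) 1) =
      2 ^ m * ((k : ℝ) / 2 ^ m * ℓ v₁ +
        ∫ t in (0 : ℝ)..1, min ((k : ℝ) / 2 ^ m) t *
          ℓ (exp ((1 - t) • fderiv ℝ Y x₀) (fderiv ℝ Y x₀ v₁))) := by
  set A := fderiv ℝ Y x₀ with hA
  set xk : Fin (2 ^ m) → ℝ := fun i => if i.val < k then (1 : ℝ) else 0 with hxk
  set δ : E × PairSkeleton m × C(I, D.noise) := (0, (xk, 0), 0) with hδ
  have hw := D.fderiv_skelSol_base_eq hY hx₀ m g hg hS huniq δ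
  have hc : (k : ℝ) / 2 ^ m ∈ Icc (0 : ℝ) 1 := by
    refine ⟨by positivity, ?_⟩
    rw [div_le_one (by positivity)]
    exact_mod_cast hk
  have hG : ∀ τ : I, g δ τ = ((2 : ℝ) ^ m * min ((k : ℝ) / 2 ^ m) (τ : ℝ)) • v₁ := by
    intro τ
    rw [hg]
    simp only [hδ, zero_add]
    rw [skelNoisePath_apply, ContinuousMap.zero_apply, ZeroMemClass.coe_zero, zero_add]
    have hpl0 : plInterp m (0 : Fin (2 ^ m) → ℝ) ((τ : ℝ).toNNReal) = 0 := by simp [plInterp]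
    have hplk : plInterp m xk ((τ : ℝ).toNNReal) = 2 ^ m * min ((k : ℝ) / 2 ^ m) (τ : ℝ) := by
      rw [hxk, plInterp_indicator m k hk, NNReal.coe_min, KolmogorovChentsov.coe_dyad, Real.coe_toNNReal _ τ.2.1]
    rw [hpl0, hplk, zero_smul, add_zero]
  rw [volterra_const_duality_ramp A ℓ v₁ hc hG hw]

end ConfinedDrift

/-! ### Vanishing of the dual functional under the Kalman hypothesis -/

/-- **If a functional annihilates all the dual values then it vanishes**, provided the pair
`(A, b)` satisfies Kalman's condition (`ℓ(Aᵏ b) = 0 ∀ k ⟹ ℓ = 0`): if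
`2ᵐ (k/2ᵐ ℓ(b) + ∫₀¹ min(k/2ᵐ, t) ℓ(e^{(1-t)A} A b) dt) = 0` for all levels `m` and all `k ≤ 2ᵐ`,
then `ℓ = 0`. [folklore] -/
theorem dual_eq_zero_of_forall_level [CompleteSpace E] (A : E →L[ℝ] E) (b : E)
    (hKal : ∀ ℓ : E →ₗ[ℝ] ℝ, (∀ k : ℕ, ℓ ((A ^ k) b) = 0) → ℓ = 0) (ℓ : E →L[ℝ] ℝ)
    (h : ∀ m k : ℕ, k ≤ 2 ^ m →
      (2 : ℝ) ^ m * ((k : ℝ) / 2 ^ m * ℓ b +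
        ∫ t in (0 : ℝ)..1, min ((k : ℝ) / 2 ^ m) t * ℓ (exp ((1 - t) • A) (A b))) = 0) :
    ℓ = 0 := by
  set ψ : ℝ → ℝ := fun t => ℓ (exp ((1 - t) • A) (A b)) with hψ
  have hψc : Continuous ψ := by
    have h1 : Continuous fun t : ℝ => exp ((1 - t) • A) :=
      (differentiable_exp_smul_const ℝ A).continuous.comp (continuous_const.sub continuous_id)
    exact ℓ.continuous.comp (h1.clm_apply continuous_const)
  set Φ : ℝ → ℝ := fun c => (∫ t in (0 : ℝ)..1, min c t * ψ t) + c * ℓ b with hΦ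
  have hΦdy : ∀ m k : ℕ, k ≤ 2 ^ m → Φ ((k : ℝ) / 2 ^ m) = 0 := by
    intro m k hk
    have h1 := h m k hk
    have hne : (2 : ℝ) ^ m ≠ 0 := by positivity
    have h2 := (mul_eq_zero.1 h1).resolve_left hne
    rw [hΦ]
    simp only
    linarith
  have hΦc : Continuous Φ := by
    have h1 : Continuous fun c : ℝ => ∫ t in (0 : ℝ)..1, min c t * ψ t := by
      refine intervalIntegral.continuous_parametric_intervalIntegral_of_continuous' ?_ 0 1
      exact (continuous_fst.min continuous_snd).mul (hψc.comp continuous_snd)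
    exact h1.add (continuous_id.mul continuous_const)
  have hΦ0 : ∀ c ∈ Icc (0 : ℝ) 1, Φ c = 0 := forall_Icc_of_forall_dyadic hΦc.continuousOn hΦdy
  obtain ⟨hψ0, hb0⟩ := eq_zero_of_integral_min_mul_add_eq_zero hψc hΦ0
  have hexp : ∀ s ∈ Icc (0 : ℝ) 1, ℓ (exp (s • A) (A b)) = 0 := by
    intro s hs
    have := hψ0 (1 - s) ⟨by linarith [hs.2], by linarith [hs.1]⟩
    simpa [hψ] using this
  have hpow : ∀ k : ℕ, ℓ ((A ^ k) (A b)) = 0 := forall_apply_pow_eq_zero_of_exp ℓ A (A b) hexp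
  have hall : ∀ k : ℕ, ℓ ((A ^ k) b) = 0 := by
    intro k
    cases k with
    | zero => simpa using hb0
    | succ k =>
      rw [pow_succ]
      exact hpow k
  have hlin := hKal (ℓ : E →ₗ[ℝ] ℝ) hall
  exact ContinuousLinearMap.coe_injective hlin

/-! ### Surjectivity at some level -/

namespace ConfinedDrift

variable [FiniteDimensional ℝ E] [CompleteSpace E] {Y : E → E} (D : ConfinedDrift Y)
  (hY : ContDiff ℝ 1 Y) {x₀ : E} (hx₀ : Y x₀ = 0)
  {v₁ v₂ : E} (hv₁ : v₁ ∈ D.noise) (hv₂ : v₂ ∈ D.noise)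
  (hKal : ∀ ℓ : E →ₗ[ℝ] ℝ, (∀ k : ℕ, ℓ (((fderiv ℝ Y x₀) ^ k) v₁) = 0) → ℓ = 0)
include D hY hx₀ hv₁ hv₂ hKal

/-- **The linearised dynamics at the equilibrium is controllable through a fine enough noise
skeleton.** Under Kalman's condition for `(DY(x₀), v₁)` there is a level `m` such that, for the
solution family `S` of level `m` (characterised by the parametric Robbin equation of the forcing
`g(z, x, ρ) = z + n_{x,ρ}`), the linear map `x ↦ DS(x₀, 0, 0)(0, x, 0)(1)` of the skeleton space
`(ℝ^{2^m})²` to `E` is ONTO. [folklore] -/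
theorem exists_skeleton_level_surjective :
    ∃ m : ℕ, ∀ (g : E × PairSkeleton m × C(I, D.noise) →L[ℝ] C(I, E))
      (_hg : ∀ (p : E × PairSkeleton m × C(I, D.noise)) (τ : I),
        g p τ = p.1 + skelNoisePath m v₁ v₂ p.2.1 p.2.2 τ)
      (S : E × PairSkeleton m × C(I, D.noise) → C(I, E))
      (_hS : ∀ p, forcedRobbinMap Y g (p, S p) = 0)
      (_huniq : ∀ p α, forcedRobbinMap Y g (p, α) = 0 → α = S p),
      LinearMap.range (((ContinuousMap.evalCLM ℝ (1 : I)).comp ((fderiv ℝ S (x₀, 0, 0)).comp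
        ((ContinuousLinearMap.inr ℝ E (PairSkeleton m × C(I, D.noise))).comp
          (ContinuousLinearMap.inl ℝ (PairSkeleton m) C(I, D.noise))))) :
            PairSkeleton m →ₗ[ℝ] E) = ⊤ := by
  classical
  -- canonical objects at every level
  have hgex : ∀ m : ℕ, ∃ g : E × PairSkeleton m × C(I, D.noise) →L[ℝ] C(I, E),
      ∀ (p : E × PairSkeleton m × C(I, D.noise)) (τ : I),
        g p τ = p.1 + skelNoisePath m v₁ v₂ p.2.1 p.2.2 τ :=
    fun m => exists_skelForcingCLM m v₁ v₂
  choose gc hgc using hgex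
  have hSex : ∀ m : ℕ, ∃ S : E × PairSkeleton m × C(I, D.noise) → C(I, E),
      (∀ p τ, S p τ = drivenFlow Y p.1 (skelNoisePath m v₁ v₂ p.2.1 p.2.2) τ) ∧
      (∀ p, forcedRobbinMap Y (gc m) (p, S p) = 0) ∧
      (∀ p α, forcedRobbinMap Y (gc m) (p, α) = 0 → α = S p) ∧ ContDiff ℝ 1 S :=
    fun m => D.exists_skelSol m hv₁ hv₂ (gc m) (hgc m) le_rfl hY
  choose Sc _hSapply hSc huniqc _hdiffc using hSex
  -- the inclusion of the skeleton and the reachability maps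
  let ι : (m : ℕ) → PairSkeleton m →L[ℝ] E × PairSkeleton m × C(I, D.noise) := fun m =>
    (ContinuousLinearMap.inr ℝ E (PairSkeleton m × C(I, D.noise))).comp
      (ContinuousLinearMap.inl ℝ (PairSkeleton m) C(I, D.noise))
  let Tc : (m : ℕ) → PairSkeleton m →ₗ[ℝ] E := fun m =>
    (((ContinuousMap.evalCLM ℝ (1 : I)).comp ((fderiv ℝ (Sc m) (x₀, 0, 0)).comp (ι m))) :
      PairSkeleton m →ₗ[ℝ] E)
  have hTc : ∀ m (x : PairSkeleton m), Tc m x = fderiv ℝ (Sc m) (x₀, 0, 0) ((0 : E), x, 0) 1 :=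
    fun m x => rfl
  let R : ℕ → Submodule ℝ E := fun m => LinearMap.range (Tc m)
  -- monotonicity by refinement
  have hmono : Monotone R := by
    refine monotone_nat_of_le_succ fun m => ?_
    rintro v ⟨x, rfl⟩
    obtain ⟨y₁, hy₁⟩ := exists_plInterp_refine m x.1
    obtain ⟨y₂, hy₂⟩ := exists_plInterp_refine m x.2
    refine ⟨(y₁, y₂), ?_⟩
    rw [hTc, hTc]
    have hw := D.fderiv_skelSol_base_eq hY hx₀ m (gc m) (hgc m) (hSc m) (huniqc m) ((0 : E), x, 0)
    have hw' := D.fderiv_skelSol_base_eq hY hx₀ (m + 1) (gc (m + 1)) (hgc (m + 1)) (hSc (m + 1))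
      (huniqc (m + 1)) ((0 : E), (y₁, y₂), 0)
    have hGeq : gc (m + 1) ((0 : E), (y₁, y₂), 0) = gc m ((0 : E), x, 0) := by
      refine ContinuousMap.ext fun τ => ?_
      rw [hgc, hgc]
      simp only [skelNoisePath_apply, ContinuousMap.zero_apply, hy₁, hy₂]
    rw [hGeq] at hw'
    have := volterra_unique _ hw' hw
    rw [this]
  -- stabilisation
  obtain ⟨M, hM⟩ := (monotone_stabilizes_iff_noetherian.2 inferInstance) ⟨R, hmono⟩
  have hM' : ∀ m, M ≤ m → R M = R m := fun m hm => hM m hm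
  -- the stable value is everything
  have htop : R M = ⊤ := by
    by_contra hne
    obtain ⟨f, hf0, hfR⟩ := Submodule.exists_dual_map_eq_bot_of_lt_top (lt_top_iff_ne_top.2 hne)
      inferInstance
    have hkill : ∀ (m : ℕ) (x : PairSkeleton m), f (Tc m x) = 0 := by
      intro m x
      have hmem : Tc m x ∈ R M := by
        rcases le_total m M with hle | hle
        · exact hmono hle ⟨x, rfl⟩
        · rw [hM' m hle]; exact ⟨x, rfl⟩
      have h1 : f (Tc m x) ∈ (R M).map f := Submodule.mem_map_of_mem hmem
      rw [hfR] at h1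
      simpa using h1
    let ℓ : E →L[ℝ] ℝ := LinearMap.toContinuousLinearMap f
    have hℓf : ∀ v, ℓ v = f v := fun v => rfl
    have hℓ : ℓ = 0 := by
      refine dual_eq_zero_of_forall_level (fderiv ℝ Y x₀) v₁ hKal ℓ fun m k hk => ?_
      rw [← D.dual_fderiv_skelSol_indicator hY hx₀ m (gc m) (hgc m) (hSc m) (huniqc m) ℓ k hk, hℓf,
        ← hTc]
      exact hkill m _
    apply hf0
    refine LinearMap.ext fun v => ?_
    rw [← hℓf, hℓ]
    rfl
  -- transfer to the given objects of level `M`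
  refine ⟨M, fun g hg S hS huniq => ?_⟩
  have hgeq : g = gc M := by
    refine ContinuousLinearMap.ext fun p => ContinuousMap.ext fun τ => ?_
    rw [hg, hgc]
  have hSeq : S = Sc M := by
    funext p
    refine huniqc M p (S p) ?_
    rw [← hgeq]
    exact hS p
  rw [hSeq]
  exact htop

end ConfinedDrift

end Literature.MathematicalPhysics.KineticTheory

end
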